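import Summits.QuantumFields.YangMills.Theorems.BalabanStepParabolic.Negative.OverTunedLimit
import Summits.QuantumFields.YangMills.Theorems.ContinuumLimitOnTrajectory.Negative.ThreePoint
import Literature.MathematicalPhysics.QuantumLattice.GaugeGroupsProofs
import Mathlib.Analysis.Calculus.BumpFunction.InnerProduct
import Mathlib.Analysis.Calculus.BumpFunction.FiniteDimension
import Mathlib.Analysis.SpecificLimits.Normed
import HarnessLib

/-!
# `BalabanStepParabolic` — negative-side support: periodic face contact, part 1 (set-up)

Support file for crux `stmt-QuantumFields-9684` (`ParabolicTrajectory.BalabanStepParabolic`), standing disprover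
(cdisprove gen 4).  Tree objects only.  Part 2 (`FaceContact`) derives `¬ BalabanStepParabolic` modulo the two
hypotheses (H₁), (H₂) defined here; this part provides

* `siteP`, `siteCov`: the action density `P_x` at a site of the periodic lift and the site covariances
  `Cov_{β,2L+1}(P_x, P_y)` under the torus Wilson state; periodicity (`siteP_eq_of_proj_eq`, `proj_add_period`,
  `siteCov_congr_right`), symmetry, boundedness, measurability, integrability;
* the hypotheses `PlaquetteCovNonneg` (H₁, GKS-type positivity) and `AdjacentCovLowerBound` (H₂, nearest-neighbour
  covariance `≥ c β^{-p}`);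
* `faceTest`, `facePair`: the FACE-TOUCHING PAIR of bumps at `(∓1/2, 0, 0, 0)` — disjoint supports in `ℝ⁴`, hence
  `isOffDiagonal_facePair` (the pair is admissible in (4c)), yet periodic images of each other's neighbourhoods;
  `blockDilate_iterate_apply`;
* `wilsonCentredSchwinger_two_eq`: the centred curvature two-point function with unit normalisations is the double
  sum `∑ₓ ∑_y g₀(x) g₁(y) Cov(P_x, P_y)`;
* `faceSite`, `dist_sample_le`, `face_coord_neg/pos`: the `M^k`-fold dilated face bumps equal `1` at the sites of the
  two opposite faces `x₀ = ∓L_k` of `box 4 L_k` with transverse coordinates `|x'ᵢ| ≤ M^k/16`.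
-/

namespace Summit.QuantumFields.YangMills.Theorems.BalabanStepParabolic.Negative

open scoped SchwartzMap
open MeasureTheory Filter Topology
open Literature.MathematicalPhysics.QuantumFieldTheory Literature.MathematicalPhysics.AQFT
open Literature.MathematicalPhysics.QuantumLattice
open Literature.Probability.LatticeModels (box mem_box card_box Torus.proj Torus.proj_apply)

noncomputable section

/-! ### Site covariances of the action density on the torus and the two hypotheses -/

section Cov

variable {G : Type} [Group G] [TopologicalSpace G] [IsTopologicalGroup G] [CompactSpace G]
  [MeasurableSpace G] [BorelSpace G] (r : LatticeRep G)

/-- `P_x(U)`: the action density (curvature species `r.curvature.F = actionDensity r.ρ`) at the site `x ∈ ℤ⁴` of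
the periodic lift of the torus configuration `U` (torus of side `2L+1`). -/
def siteP (L : ℕ) (x : Fin 4 → ℤ) (U : GaugeConfig 4 (2 * L + 1) G) : ℝ :=
  actionDensity r.ρ (configShift (-x) (torusLift (2 * L + 1) U))

/-- `Cov_{β,2L+1}(P_x, P_y) = ∫ (P_x − ⟨P⟩)(P_y − ⟨P⟩) dμ_β`: the covariance of the action densities at two sites under
the torus Wilson state (centring by the torus Wilson mean `wilsonTorusMean`, as in `wilsonCentredSchwinger`). -/
def siteCov (β : ℝ) (L : ℕ) (x y : Fin 4 → ℤ) : ℝ :=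
  ∫ U, (siteP r L x U - wilsonTorusMean r.ρ β L (actionDensity r.ρ)) *
      (siteP r L y U - wilsonTorusMean r.ρ β L (actionDensity r.ρ))
    ∂(wilsonMeasure (d := 4) (L := 2 * L + 1) r.ρ β)

/-- **(H₁) Plaquette-covariance positivity** (a Griffiths/GKS-II-type correlation inequality for the action density of
the Wilson theory of `(G, r)` at large `β` on large odd tori): `0 ≤ Cov_{β,2L+1}(P_x, P_y)` for all sites.  Known for
abelian/ferromagnetic models; OPEN for non-abelian lattice gauge theory (no Griffiths inequalities are available);
its leading weak-coupling (Gaussian) approximation is a sum of squares. -/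
def PlaquetteCovNonneg : Prop :=
  ∃ β₁ : ℝ, ∃ L₁ : ℕ, ∀ β : ℝ, β₁ ≤ β → ∀ L : ℕ, L₁ ≤ L → ∀ x y : Fin 4 → ℤ, 0 ≤ siteCov r β L x y

/-- **(H₂) Nearest-neighbour covariance lower bound** at weak coupling, uniformly in the volume:
`c β^{-p} ≤ Cov_{β,2L+1}(P_x, P_{x+e₀})`.  Perturbatively the left side is `const(G,r)·β⁻² (1 + O(β⁻¹))` with a
positive constant (neighbouring action densities share links); a proof in `d = 4` at weak coupling is OPEN. -/
def AdjacentCovLowerBound : Prop :=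
  ∃ c : ℝ, 0 < c ∧ ∃ p : ℕ, ∃ β₁ : ℝ, ∃ L₁ : ℕ, ∀ β : ℝ, β₁ ≤ β → ∀ L : ℕ, L₁ ≤ L →
    ∀ x : Fin 4 → ℤ, c / β ^ p ≤ siteCov r β L x (x + Pi.single 0 1)

omit [IsTopologicalGroup G] [CompactSpace G] [BorelSpace G] in
/-- The action density of the shifted lift in terms of torus plaquette deficits: it depends on `x` only through
`x mod (2L+1)`. [folklore] -/
theorem siteP_eq (L : ℕ) (x : Fin 4 → ℤ) (U : GaugeConfig 4 (2 * L + 1) G) :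
    siteP r L x U = Pmax r -
      ∑ i : Fin 4, ∑ j : Fin 4, (if i < j then pDef r U (Torus.proj (2 * L + 1) x) i j else 0) := by
  have h := Pmax_sub_actionDensity r (2 * L + 1) U x
  unfold siteP
  linarith

omit [IsTopologicalGroup G] [CompactSpace G] [BorelSpace G] in
/-- **Periodicity**: sites with the same image on the torus carry the same action density. [folklore] -/
theorem siteP_eq_of_proj_eq (L : ℕ) {x y : Fin 4 → ℤ} (h : Torus.proj (2 * L + 1) x = Torus.proj (2 * L + 1) y) :
    siteP r L x = siteP r L y := by
  funext U
  rw [siteP_eq, siteP_eq, h]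

omit [Group G] [TopologicalSpace G] [IsTopologicalGroup G] [CompactSpace G] [MeasurableSpace G]
  [BorelSpace G] in
/-- Translating a site by a multiple of the period does not change its torus image. [folklore] -/
theorem proj_add_period (T : ℕ) (x v : Fin 4 → ℤ) :
    Torus.proj T (x + (T : ℤ) • v) = Torus.proj T x := by
  funext i
  simp only [Torus.proj_apply, Pi.add_apply, Pi.smul_apply, smul_eq_mul, Int.cast_add, Int.cast_mul,
    Int.cast_natCast, ZMod.natCast_self, zero_mul, add_zero]

/-- Covariances are symmetric. [folklore] -/
theorem siteCov_comm (β : ℝ) (L : ℕ) (x y : Fin 4 → ℤ) : siteCov r β L x y = siteCov r β L y x := by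
  unfold siteCov
  congr 1
  funext U
  ring

/-- Periodicity of covariances in the second site. [folklore] -/
theorem siteCov_congr_right (β : ℝ) (L : ℕ) (x : Fin 4 → ℤ) {y y' : Fin 4 → ℤ}
    (h : Torus.proj (2 * L + 1) y = Torus.proj (2 * L + 1) y') :
    siteCov r β L x y = siteCov r β L x y' := by
  unfold siteCov
  have e := siteP_eq_of_proj_eq r L h
  simp_rw [e]

/-- The action density is bounded. [folklore] -/
theorem exists_siteP_bound : ∃ C : ℝ, 0 ≤ C ∧ ∀ (L : ℕ) (x : Fin 4 → ℤ) (U : GaugeConfig 4 (2 * L + 1) G),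
    |siteP r L x U| ≤ C := by
  obtain ⟨C, hC⟩ := r.curvature.bounded
  refine ⟨max C 0, le_max_right _ _, fun L x U => ?_⟩
  have h := hC (configShift (-x) (torusLift (2 * L + 1) U))
  rw [curvature_F] at h
  exact h.trans (le_max_left _ _)

/-- The action density of the shifted lift is measurable on torus configurations. [folklore] -/
theorem measurable_siteP (L : ℕ) (x : Fin 4 → ℤ) : Measurable (siteP r L x) := by
  haveI := secondCountable_of_latticeRep r
  have hm := r.curvature.measurable
  rw [curvature_F] at hm
  exact hm.comp ((configShift (-x)).measurable.comp (measurable_torusLift _))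

/-- Integrability of products of centred action densities under the torus Wilson state. [folklore] -/
theorem integrable_centred_mul (β : ℝ) (L : ℕ) (x y : Fin 4 → ℤ) (m a b : ℝ) :
    Integrable (fun U => (a * (siteP r L x U - m)) * (b * (siteP r L y U - m)))
      (wilsonMeasure (d := 4) (L := 2 * L + 1) r.ρ β) := by
  obtain ⟨C, hC0, hC⟩ := exists_siteP_bound r
  refine integrable_wilson_of_bound r L β ?_ (C := |a| * (C + |m|) * (|b| * (C + |m|))) fun U => ?_
  · exact (((measurable_siteP r L x).sub_const m).const_mul a).mul
      (((measurable_siteP r L y).sub_const m).const_mul b)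
  · rw [abs_mul, abs_mul, abs_mul]
    have hx : |siteP r L x U - m| ≤ C + |m| := (abs_sub _ _).trans (add_le_add (hC L x U) le_rfl)
    have hy : |siteP r L y U - m| ≤ C + |m| := (abs_sub _ _).trans (add_le_add (hC L y U) le_rfl)
    gcongr

end Cov

/-! ### The face-touching pair of test functions -/

section Bumps

/-- The face point `(s, 0, 0, 0)` of `ℝ⁴`. -/
def facePt (s : ℝ) : EuclideanSpace ℝ (Fin 4) := WithLp.toLp 2 (Pi.single 0 s)

/-- First coordinate of the face point. [folklore] -/
@[simp] theorem facePt_apply_zero (s : ℝ) : facePt s 0 = s := by simp [facePt]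

/-- Transverse coordinates of the face point vanish. [folklore] -/
@[simp] theorem facePt_apply_succ (s : ℝ) (i : Fin 3) : facePt s i.succ = 0 := by
  simp [facePt, Fin.succ_ne_zero]

/-- The two face points are at distance `1`. [folklore] -/
theorem dist_facePt : dist (facePt (-(1 / 2))) (facePt (1 / 2)) = 1 := by
  rw [EuclideanSpace.dist_eq, Fin.sum_univ_succ]
  simp only [facePt_apply_zero, facePt_apply_succ, dist_self, ne_eq, OfNat.ofNat_ne_zero,
    not_false_eq_true, zero_pow, Finset.sum_const_zero, add_zero]
  rw [Real.dist_eq, show (-(1 / 2) - 1 / 2 : ℝ) = -1 by norm_num, abs_neg, abs_one, one_pow, Real.sqrt_one]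

/-- A smooth bump around the face point `(s,0,0,0)`: `= 1` on the closed ball of radius `1/8`, supported in the
ball of radius `1/4`, with values in `[0, 1]` (Mathlib `ContDiffBump`). -/
def faceBump (s : ℝ) : ContDiffBump (facePt s) := ⟨1 / 8, 1 / 4, by norm_num, by norm_num⟩

/-- The face bump as a real Schwartz test function. -/
def faceTest (s : ℝ) : 𝓢(EuclideanSpace ℝ (Fin 4), ℝ) :=
  (faceBump s).hasCompactSupport.toSchwartzMap (faceBump s).contDiff

/-- Values of the face test function. [folklore] -/
theorem faceTest_apply (s : ℝ) (u : EuclideanSpace ℝ (Fin 4)) : faceTest s u = faceBump s u := rfl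

/-- The face test function is non-negative. [folklore] -/
theorem faceTest_nonneg (s : ℝ) (u : EuclideanSpace ℝ (Fin 4)) : 0 ≤ faceTest s u := (faceBump s).nonneg

/-- The face test function equals `1` on the plateau ball of radius `1/8`. [folklore] -/
theorem faceTest_eq_one (s : ℝ) {u : EuclideanSpace ℝ (Fin 4)} (hu : dist u (facePt s) ≤ 1 / 8) :
    faceTest s u = 1 :=
  (faceBump s).one_of_mem_closedBall (Metric.mem_closedBall.2 hu)

/-- The support of the face test function is the closed ball of radius `1/4`. [folklore] -/
theorem tsupport_faceTest (s : ℝ) :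
    tsupport (faceTest s : EuclideanSpace ℝ (Fin 4) → ℝ) = Metric.closedBall (facePt s) (1 / 4) :=
  (faceBump s).tsupport_eq

/-- **The face-touching pair** `(f⁻, f⁺)`: bumps at the two face points `(∓1/2, 0, 0, 0)` of the unit fundamental
domain `[-1/2, 1/2]⁴` of the base torus `2·0+1`. -/
def facePair : Fin 2 → 𝓢(EuclideanSpace ℝ (Fin 4), ℝ) := ![faceTest (-(1 / 2)), faceTest (1 / 2)]

/-- The two supports are disjoint IN `ℝ⁴` (closed balls of radius `1/4` at distance `1`). [folklore] -/
theorem disjoint_tsupport_facePair :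
    Disjoint (tsupport (faceTest (-(1 / 2)) : EuclideanSpace ℝ (Fin 4) → ℝ))
      (tsupport (faceTest (1 / 2) : EuclideanSpace ℝ (Fin 4) → ℝ)) := by
  rw [tsupport_faceTest, tsupport_faceTest]
  exact Metric.closedBall_disjoint_closedBall (by rw [dist_facePt]; norm_num)

/-- **The pair is off-diagonal** in the sense of (4c) (`⁰𝒮(ℝ⁴ˣ²)`). [folklore] -/
theorem isOffDiagonal_facePair :
    IsOffDiagonal (SchwartzMap.tensorFin 2 fun i => ofRealTest (facePair i)) :=
  ContinuumLimitOnTrajectory.Negative.isOffDiagonal_Tn facePair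
    (ContinuumLimitOnTrajectory.Negative.pairwise_two disjoint_tsupport_facePair)

/-- Values of `k`-fold block-dilated test functions: `((blockDilate M)^[k] f) u = f (M^{-k} u)`. [folklore] -/
theorem blockDilate_iterate_apply {M : ℕ} (hM : M ≠ 0) (k : ℕ) (f : 𝓢(EuclideanSpace ℝ (Fin 4), ℝ))
    (u : EuclideanSpace ℝ (Fin 4)) : ((blockDilate M)^[k] f) u = f ((((M : ℝ) ^ k)⁻¹) • u) := by
  induction k generalizing u with
  | zero => simp
  | succ k ih =>
    rw [Function.iterate_succ_apply', blockDilate_apply hM, ih, smul_smul, pow_succ, mul_inv]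

end Bumps

/-! ### The two-point function of the curvature species as a double sum of site covariances -/

section Expansion

variable {G : Type} [Group G] [TopologicalSpace G] [IsTopologicalGroup G] [CompactSpace G]
  [MeasurableSpace G] [BorelSpace G] (r : LatticeRep G)

/-- The smeared centred curvature field at unit scale and unit normalisation is `∑ₓ g(x) (P_x − ⟨P⟩)`. [folklore] -/
theorem smeared_curvature_eq (β : ℝ) (L : ℕ) (g : 𝓢(EuclideanSpace ℝ (Fin 4), ℝ))
    (U : GaugeConfig 4 (2 * L + 1) G) :
    smearedLatticeField r.curvature.F (box 4 L) 1 1 (wilsonTorusMean r.ρ β L r.curvature.F) g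
        (torusLift (2 * L + 1) U) =
      ∑ x ∈ box 4 L, g (siteToE x) * (siteP r L x U - wilsonTorusMean r.ρ β L (actionDensity r.ρ)) := by
  simp [smearedLatticeField, siteP, curvature_F]

/-- **Double-sum expansion**: the centred curvature two-point function on the torus `2L+1` with unit
normalisations is `∑ₓ ∑_y g₀(x) g₁(y) Cov_{β,2L+1}(P_x, P_y)`. [folklore] -/
theorem wilsonCentredSchwinger_two_eq (β : ℝ) (L : ℕ) (g : Fin 2 → 𝓢(EuclideanSpace ℝ (Fin 4), ℝ)) :
    wilsonCentredSchwinger r.ρ β L (fun _ => 1) 2 (fun _ => r.curvature) g =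
      ∑ x ∈ box 4 L, ∑ y ∈ box 4 L, g 0 (siteToE x) * g 1 (siteToE y) * siteCov r β L x y := by
  unfold wilsonCentredSchwinger
  simp only [Fin.prod_univ_two, smeared_curvature_eq]
  set m := wilsonTorusMean r.ρ β L (actionDensity r.ρ) with hm
  simp_rw [Finset.sum_mul_sum]
  rw [integral_finsetSum _ (fun x _ => integrable_finsetSum _ fun y _ =>
    integrable_centred_mul r β L x y m _ _)]
  refine Finset.sum_congr rfl fun x _ => ?_
  rw [integral_finsetSum _ (fun y _ => integrable_centred_mul r β L x y m _ _)]
  refine Finset.sum_congr rfl fun y _ => ?_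
  unfold siteCov
  rw [← integral_const_mul]
  refine integral_congr_ae (ae_of_all _ fun U => ?_)
  simp only
  ring

end Expansion

/-! ### Geometry of the face samples -/

section Geometry

/-- Face sites `(a, x') ∈ ℤ × ℤ³`. -/
def faceSite (a : ℤ) (x' : Fin 3 → ℤ) : Fin 4 → ℤ := Fin.cons a x'

/-- First coordinate of a face site. [folklore] -/
@[simp] theorem faceSite_zero (a : ℤ) (x' : Fin 3 → ℤ) : faceSite a x' 0 = a := by simp [faceSite]

/-- Transverse coordinates of a face site. [folklore] -/
@[simp] theorem faceSite_succ (a : ℤ) (x' : Fin 3 → ℤ) (i : Fin 3) : faceSite a x' i.succ = x' i := by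
  simp [faceSite]

/-- Face sites with a fixed first coordinate are parametrised injectively by their transverse coordinates. [folklore] -/
theorem faceSite_injective (a : ℤ) : Function.Injective (faceSite a) := fun x y h => by
  simpa [faceSite] using h

/-- Face sites of a box. [folklore] -/
theorem faceSite_mem_box {L : ℕ} {a : ℤ} {x' : Fin 3 → ℤ} (ha : -(L : ℤ) ≤ a ∧ a ≤ L)
    (hx : ∀ i, -(L : ℤ) ≤ x' i ∧ x' i ≤ L) : faceSite a x' ∈ box 4 L := by
  rw [mem_box]
  refine Fin.cases ?_ (fun i => ?_)
  · simpa using ha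
  · simpa using hx i

/-- Opposite faces are torus neighbours: `(L+1, x') = (-L, x') + (2L+1)·e₀`. [folklore] -/
theorem faceSite_add_single (L : ℕ) (x' : Fin 3 → ℤ) :
    faceSite (L : ℤ) x' + Pi.single 0 1 = faceSite (-(L : ℤ)) x' + ((2 * L + 1 : ℕ) : ℤ) • Pi.single 0 1 := by
  funext i
  refine Fin.cases ?_ (fun j => ?_) i
  · simp; ring
  · simp [Fin.succ_ne_zero]

/-- **The dilated face samples lie on the plateau.** For `T ≥ 16`, transverse coordinates `|x'ᵢ| ≤ m ≤ T/16` and a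
first coordinate `a` with `(a/T − c)² ≤ (1/(2T))²`, the point `T⁻¹ (a, x')` is within `1/8` of the face point
`(c, 0, 0, 0)`. [folklore] -/
theorem dist_sample_le {T : ℕ} (hT : 16 ≤ T) {a : ℤ} {c : ℝ}
    (h0 : (((T : ℝ))⁻¹ * (a : ℝ) - c) ^ 2 ≤ (1 / 32) ^ 2) {m : ℕ} (hm : m ≤ T / 16)
    {x' : Fin 3 → ℤ} (hx : ∀ i, -(m : ℤ) ≤ x' i ∧ x' i ≤ m) :
    dist (((T : ℝ))⁻¹ • siteToE (faceSite a x')) (facePt c) ≤ 1 / 8 := by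
  have hT0 : (0 : ℝ) < T := by exact_mod_cast (show 0 < T by omega)
  have hmT : (m : ℝ) ≤ (T : ℝ) / 16 := by
    have h1 : (m : ℝ) ≤ ((T / 16 : ℕ) : ℝ) := by exact_mod_cast hm
    exact h1.trans (Nat.cast_div_le)
  have h2 : ∀ i, (((T : ℝ))⁻¹ * (x' i : ℝ)) ^ 2 ≤ (1 / 16) ^ 2 := fun i => by
    have hxi : |(x' i : ℝ)| ≤ m := by
      rw [← Int.cast_abs]; exact_mod_cast abs_le.2 (hx i)
    have hle : |((T : ℝ))⁻¹ * (x' i : ℝ)| ≤ 1 / 16 := by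
      rw [abs_mul, abs_inv, Nat.abs_cast]
      calc ((T : ℝ))⁻¹ * |(x' i : ℝ)| ≤ ((T : ℝ))⁻¹ * ((T : ℝ) / 16) :=
            mul_le_mul_of_nonneg_left (hxi.trans hmT) (by positivity)
        _ = 1 / 16 := by field_simp
    calc (((T : ℝ))⁻¹ * (x' i : ℝ)) ^ 2 = |((T : ℝ))⁻¹ * (x' i : ℝ)| ^ 2 := (sq_abs _).symm
      _ ≤ (1 / 16) ^ 2 := pow_le_pow_left₀ (abs_nonneg _) hle 2
  have hsum : ∑ i, dist ((((T : ℝ))⁻¹ • siteToE (faceSite a x')) i) (facePt c i) ^ 2 ≤ (1 / 8) ^ 2 := by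
    rw [Fin.sum_univ_succ]
    simp only [PiLp.smul_apply, siteToE_apply, faceSite_zero, faceSite_succ, facePt_apply_zero,
      facePt_apply_succ, smul_eq_mul, Real.dist_eq, sq_abs, sub_zero]
    have h3 : ∑ i : Fin 3, (((T : ℝ))⁻¹ * (x' i : ℝ)) ^ 2 ≤ ∑ _i : Fin 3, ((1 : ℝ) / 16) ^ 2 :=
      Finset.sum_le_sum fun i _ => h2 i
    have h4 : ∑ _i : Fin 3, ((1 : ℝ) / 16) ^ 2 = 3 * (1 / 16) ^ 2 := by simp
    rw [h4] at h3
    have : ((1 : ℝ) / 32) ^ 2 + 3 * (1 / 16) ^ 2 ≤ (1 / 8) ^ 2 := by norm_num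
    linarith
  rw [EuclideanSpace.dist_eq]
  calc Real.sqrt (∑ i, dist ((((T : ℝ))⁻¹ • siteToE (faceSite a x')) i) (facePt c i) ^ 2)
      ≤ Real.sqrt ((1 / 8) ^ 2) := Real.sqrt_le_sqrt hsum
    _ = 1 / 8 := Real.sqrt_sq (by norm_num)

/-- `(1/(2T))² ≤ (1/32)²` for `T ≥ 16`. [folklore] -/
theorem inv_two_T_sq_le {T : ℕ} (hT16 : 16 ≤ T) : (1 / (2 * (T : ℝ))) ^ 2 ≤ (1 / 32) ^ 2 := by
  have h32 : (1 : ℝ) / (2 * T) ≤ 1 / 32 :=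
    one_div_le_one_div_of_le (by norm_num) (by exact_mod_cast (show 32 ≤ 2 * T by omega))
  exact pow_le_pow_left₀ (by positivity) h32 2

/-- The first-coordinate condition at the left face `a = -L`, `c = -1/2` of the torus `2L+1 = T ≥ 16`. [folklore] -/
theorem face_coord_neg {T L : ℕ} (hT : 2 * L + 1 = T) (hT16 : 16 ≤ T) :
    (((T : ℝ))⁻¹ * (((-(L : ℤ)) : ℤ) : ℝ) - (-(1 / 2))) ^ 2 ≤ (1 / 32) ^ 2 := by
  have hTr : (T : ℝ) = 2 * L + 1 := by exact_mod_cast hT.symm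
  have hL : (2 * (L : ℝ) + 1) ≠ 0 := by positivity
  have hkey : ((T : ℝ))⁻¹ * (((-(L : ℤ)) : ℤ) : ℝ) - (-(1 / 2)) = 1 / (2 * T) := by
    rw [hTr]
    push_cast
    field_simp
    ring
  rw [hkey]
  exact inv_two_T_sq_le hT16

/-- The first-coordinate condition at the right face `a = L`, `c = 1/2`. [folklore] -/
theorem face_coord_pos {T L : ℕ} (hT : 2 * L + 1 = T) (hT16 : 16 ≤ T) :
    (((T : ℝ))⁻¹ * (((L : ℤ) : ℤ) : ℝ) - 1 / 2) ^ 2 ≤ (1 / 32) ^ 2 := by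
  have hTr : (T : ℝ) = 2 * L + 1 := by exact_mod_cast hT.symm
  have hL : (2 * (L : ℝ) + 1) ≠ 0 := by positivity
  have hkey : ((T : ℝ))⁻¹ * (((L : ℤ) : ℤ) : ℝ) - 1 / 2 = -(1 / (2 * T)) := by
    rw [hTr]
    push_cast
    field_simp
    ring
  rw [hkey, neg_sq]
  exact inv_two_T_sq_le hT16

end Geometry


end

end Summit.QuantumFields.YangMills.Theorems.BalabanStepParabolic.Negative
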